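import Summits.ValiantsHypothesis.ValiantsHypothesis.Theorems.KPlusLogSqLawTropicalBMarkedEdgeCoreRising
import Summits.ValiantsHypothesis.ValiantsHypothesis.Theorems.KPlusLogSqLawTropicalBMarkedEdgeCyclicOrder

/-!
# Route «KPlusLogSqLaw», crux `TropicalB` (stmt-ValiantsHypothesis-19771) — MARKED-EDGE sector, NESTED-TRIANGLE CORE, ALL sizes:
# RIGIDITY LEMMA A — two rising colours forming one cycle agree along their `b4`-chains up to any common node unreachable from `b0`

HONEST FRAMING.  Helper file (cell `pub-symmetroid`, seat val-sym-trop-p4 (g21), 2026-08-29; `--supports stmt-ValiantsHypothesis-19771 --as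
helper`).  Pure combinatorics (no realisation in the hypotheses): the RIGIDITY LEMMA A of this seat's memo HOME/val-sym-trop-p4/g21/RIGIDITY-g21.md
§2, the main engine of the (located) THEOREM D1 / THEOREM K1.  Nothing here proves the nested-triangle law; nothing concerns `TropicalB` in its
window, `WeakLifting`, the doors, `MatrixDescartes` (stmt-ValiantsHypothesis-18050) or VP ≠ VNP.

SETTING (generic).  `x y : Equiv.Perm V` («relative colours», e.g. `σZ⁻¹σB`, `σZ⁻¹σC`), gates `s` (= `b4`) and `t` (= `b0`), a HEIGHT
`h : V → ℕ` that strictly increases along every arc `i → x i`, `i → y i` between non-gate nodes (`core_exists_height`), and a set `U` of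
non-gate nodes CLOSED UNDER PREDECESSORS (`x i ∈ U`, `x i ≠ i` ⇒ `i ∈ U ∨ i = s`; e.g. the nodes unreachable from `t`).  The `s`-prefix of `x` of
length `n` is `s, x s, …, xⁿ s`.

* `backward_orbit` — a node of `U` moved by `x` lies on the `s`-chain of `x` with all earlier chain nodes in `U`.
* `prefix_rigidity` — **LEMMA A.**  If `x⁻¹y` is ONE cycle (pair exchange), the `x`-prefix of length `n` and the `y`-prefix of length `m` stay
  in `U` and END AT THE SAME NODE, and `x, y` differ at some node outside `U ∪ {s}`, then `n = m` and the two prefixes coincide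
  (`xᵏ s = yᵏ s` for all `k ≤ n`).  Proof: private nodes of either prefix are fixed by the other colour (`backward_orbit` + heights), so the
  union `S` of the two prefixes (without the common end) satisfies `y S ⊆ x S`; `agree_off_of_isCycle` (p694601) forbids a disagreement both
  inside and outside `S`.
-/

set_option linter.dupNamespace false
set_option autoImplicit false

namespace Summit.ValiantsHypothesis.ValiantsHypothesis.Theorems.KPlusLogSqLaw
namespace MarkedEdge
namespace Core

open Finset

variable {V : Type*} [Fintype V] [DecidableEq V]

omit [Fintype V] [DecidableEq V] in
/-- Successor along the chain: `x^(k+1) s = x (x^k s)`. [folklore] -/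
theorem pow_succ_apply (x : Equiv.Perm V) (k : ℕ) (i : V) : (x ^ (k + 1)) i = x ((x ^ k) i) := by
  rw [pow_succ', Equiv.Perm.mul_apply]

section Rising

variable (x : Equiv.Perm V) (s t : V) (h : V → ℕ)

omit [Fintype V] [DecidableEq V] in
/-- Heights increase along a chain segment that stays among non-gate nodes. [folklore] -/
theorem height_mono_chain
    (hx : ∀ i, i ≠ s → i ≠ t → x i ≠ s → x i ≠ t → x i ≠ i → h i < h (x i)) (hs : x s ≠ s)
    {a b : ℕ} (hab : a ≤ b) (hW : ∀ k, a ≤ k → k ≤ b → (x ^ k) s ≠ s ∧ (x ^ k) s ≠ t) :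
    h ((x ^ a) s) + (b - a) ≤ h ((x ^ b) s) := by
  induction b with
  | zero =>
    have : a = 0 := by omega
    subst this; simp
  | succ b ih =>
    rcases Nat.eq_or_lt_of_le hab with hEq | hlt
    · rw [hEq]; simp
    · have hab' : a ≤ b := by omega
      have ih' := ih hab' (fun k hk1 hk2 => hW k hk1 (by omega))
      have hb := hW b hab' (by omega)
      have hb1 := hW (b + 1) (by omega) le_rfl
      rw [pow_succ_apply] at hb1 ⊢
      have hstep := hx _ hb.1 hb.2 hb1.1 hb1.2 (FourBit.pow_apply_ne_self x hs b)
      omega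

omit [Fintype V] in
/-- **Backward orbit.**  If `U` (a set of non-gate nodes) is closed under `x`-predecessors and `b ∈ U` is moved by `x`, then `b = x^j s` for some
`j ≥ 1` with `x^i s ∈ U` for all `1 ≤ i ≤ j`; in particular `x` moves `s`. [this seat's lemma] -/
theorem backward_orbit
    (hx : ∀ i, i ≠ s → i ≠ t → x i ≠ s → x i ≠ t → x i ≠ i → h i < h (x i))
    (U : Finset V) (hsU : s ∉ U) (htU : t ∉ U) (hUx : ∀ i, x i ∈ U → x i ≠ i → i ∈ U ∨ i = s) :
    ∀ N : ℕ, ∀ b : V, h b ≤ N → b ∈ U → x b ≠ b → ∃ j : ℕ, 1 ≤ j ∧ (x ^ j) s = b ∧ ∀ i, 1 ≤ i → i ≤ j → (x ^ i) s ∈ U := by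
  intro N
  induction N with
  | zero =>
    intro b hb hbU hxb
    -- predecessor c of b: either s (done) or in U with smaller height (impossible at height 0)
    set c := x⁻¹ b with hc
    have hxc : x c = b := by rw [hc]; simp
    by_cases hcs : c = s
    · refine ⟨1, le_rfl, by rw [pow_one, ← hcs, hxc], fun i hi1 hi2 => ?_⟩
      have : i = 1 := by omega
      subst this; rw [pow_one, ← hcs, hxc]; exact hbU
    · exfalso
      have hcm : x c ≠ c := by
        intro h'
        have hbc : b = c := hxc.symm.trans h'
        apply hxb; rw [hbc]; exact h'
      have hcU : c ∈ U := by
        rcases hUx c (by rw [hxc]; exact hbU) hcm with h' | h'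
        · exact h'
        · exact absurd h' hcs
      have hlt := hx c (fun h' => hsU (h' ▸ hcU)) (fun h' => htU (h' ▸ hcU)) (by rw [hxc]; exact fun h' => hsU (h' ▸ hbU))
        (by rw [hxc]; exact fun h' => htU (h' ▸ hbU)) hcm
      rw [hxc] at hlt; omega
  | succ N ih =>
    intro b hb hbU hxb
    set c := x⁻¹ b with hc
    have hxc : x c = b := by rw [hc]; simp
    by_cases hcs : c = s
    · refine ⟨1, le_rfl, by rw [pow_one, ← hcs, hxc], fun i hi1 hi2 => ?_⟩
      have : i = 1 := by omega
      subst this; rw [pow_one, ← hcs, hxc]; exact hbU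
    · have hcm : x c ≠ c := by
        intro h'
        have hbc : b = c := hxc.symm.trans h'
        apply hxb; rw [hbc]; exact h'
      have hcU : c ∈ U := by
        rcases hUx c (by rw [hxc]; exact hbU) hcm with h' | h'
        · exact h'
        · exact absurd h' hcs
      have hlt := hx c (fun h' => hsU (h' ▸ hcU)) (fun h' => htU (h' ▸ hcU)) (by rw [hxc]; exact fun h' => hsU (h' ▸ hbU))
        (by rw [hxc]; exact fun h' => htU (h' ▸ hbU)) hcm
      rw [hxc] at hlt
      obtain ⟨j, hj1, hjc, hjU⟩ := ih c (by omega) hcU hcm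
      refine ⟨j + 1, by omega, by rw [pow_succ_apply, hjc, hxc], fun i hi1 hi2 => ?_⟩
      rcases Nat.eq_or_lt_of_le hi2 with hEq | hlt'
      · rw [hEq, pow_succ_apply, hjc, hxc]; exact hbU
      · exact hjU i hi1 (by omega)

end Rising

/-- **RIGIDITY LEMMA A (prefix rigidity).**  Let `x, y` be permutations with `x⁻¹y` a single cycle, both rising for the height `h` between
non-gate nodes, and `U ∌ s, t` closed under `x`- and `y`-predecessors.  Suppose the `x`-prefix `x s, …, xⁿ s` and the `y`-prefix
`y s, …, yᵐ s` (`n, m ≥ 1`) lie in `U` and end at the same node, and `x d ≠ y d` for some `d ∉ U`, `d ≠ s`.  Then `n = m` and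
`xᵏ s = yᵏ s` for every `k ≤ n`. [this seat's theorem — LEMMA A of RIGIDITY-g21.md] -/
theorem prefix_rigidity (x y : Equiv.Perm V) (hc : (x⁻¹ * y).IsCycle) (s t : V) (h : V → ℕ)
    (hx : ∀ i, i ≠ s → i ≠ t → x i ≠ s → x i ≠ t → x i ≠ i → h i < h (x i))
    (hy : ∀ i, i ≠ s → i ≠ t → y i ≠ s → y i ≠ t → y i ≠ i → h i < h (y i))
    (U : Finset V) (hsU : s ∉ U) (htU : t ∉ U)
    (hUx : ∀ i, x i ∈ U → x i ≠ i → i ∈ U ∨ i = s) (hUy : ∀ i, y i ∈ U → y i ≠ i → i ∈ U ∨ i = s)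
    {n m : ℕ} (hn : 1 ≤ n) (hm : 1 ≤ m)
    (hxn : ∀ k, 1 ≤ k → k ≤ n → (x ^ k) s ∈ U) (hym : ∀ k, 1 ≤ k → k ≤ m → (y ^ k) s ∈ U)
    (hv : (x ^ n) s = (y ^ m) s)
    {d : V} (hd : x d ≠ y d) (hdU : d ∉ U) (hds : d ≠ s) :
    n = m ∧ ∀ k, k ≤ n → (x ^ k) s = (y ^ k) s := by
  -- basic facts: both colours move `s`; prefix nodes are non-gates
  have hxs : x s ≠ s := fun h' => hsU (by have := hxn 1 le_rfl hn; rwa [pow_one, h'] at this)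
  have hys : y s ≠ s := fun h' => hsU (by have := hym 1 le_rfl hm; rwa [pow_one, h'] at this)
  have hWx : ∀ k, 1 ≤ k → k ≤ n → (x ^ k) s ≠ s ∧ (x ^ k) s ≠ t :=
    fun k hk1 hk2 => ⟨fun h' => hsU (h' ▸ hxn k hk1 hk2), fun h' => htU (h' ▸ hxn k hk1 hk2)⟩
  have hWy : ∀ k, 1 ≤ k → k ≤ m → (y ^ k) s ≠ s ∧ (y ^ k) s ≠ t :=
    fun k hk1 hk2 => ⟨fun h' => hsU (h' ▸ hym k hk1 hk2), fun h' => htU (h' ▸ hym k hk1 hk2)⟩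
  -- heights along the prefixes
  have hmx : ∀ a b, 1 ≤ a → a ≤ b → b ≤ n → h ((x ^ a) s) + (b - a) ≤ h ((x ^ b) s) :=
    fun a b ha hab hb => height_mono_chain x s t h hx hxs hab (fun k hk1 hk2 => hWx k (by omega) (by omega))
  have hmy : ∀ a b, 1 ≤ a → a ≤ b → b ≤ m → h ((y ^ a) s) + (b - a) ≤ h ((y ^ b) s) :=
    fun a b ha hab hb => height_mono_chain y s t h hy hys hab (fun k hk1 hk2 => hWy k (by omega) (by omega))
  -- KEY: a `y`-prefix node moved by `x` is an `x`-prefix node (strictly before the end), and symmetrically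
  have key_yx : ∀ l, 1 ≤ l → l < m → x ((y ^ l) s) ≠ (y ^ l) s → ∃ k, 1 ≤ k ∧ k < n ∧ (x ^ k) s = (y ^ l) s := by
    intro l hl1 hlm hmov
    obtain ⟨j, hj1, hjb, hjU⟩ := backward_orbit x s t h hx U hsU htU hUx _ _ le_rfl (hym l hl1 hlm.le) hmov
    refine ⟨j, hj1, ?_, hjb⟩
    by_contra hjn
    push Not at hjn
    -- then v = x^n s lies on the x-chain before (or at) x^j s = y^l s, while the y-chain climbs from y^l s to v = y^m s
    have h1 : h ((x ^ n) s) + (j - n) ≤ h ((x ^ j) s) :=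
      height_mono_chain x s t h hx hxs hjn (fun k hk1 hk2 =>
        ⟨fun h' => hsU (h' ▸ hjU k (by omega) hk2), fun h' => htU (h' ▸ hjU k (by omega) hk2)⟩)
    have h2 : h ((y ^ l) s) + (m - l) ≤ h ((y ^ m) s) := hmy l m hl1 hlm.le le_rfl
    rw [hjb] at h1; rw [← hv] at h2
    omega
  have key_xy : ∀ k, 1 ≤ k → k < n → y ((x ^ k) s) ≠ (x ^ k) s → ∃ l, 1 ≤ l ∧ l < m ∧ (y ^ l) s = (x ^ k) s := by
    intro k hk1 hkn hmov
    obtain ⟨j, hj1, hjb, hjU⟩ := backward_orbit y s t h hy U hsU htU hUy _ _ le_rfl (hxn k hk1 hkn.le) hmov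
    refine ⟨j, hj1, ?_, hjb⟩
    by_contra hjm
    push Not at hjm
    have h1 : h ((y ^ m) s) + (j - m) ≤ h ((y ^ j) s) :=
      height_mono_chain y s t h hy hys hjm (fun k' hk1 hk2 =>
        ⟨fun h' => hsU (h' ▸ hjU k' (by omega) hk2), fun h' => htU (h' ▸ hjU k' (by omega) hk2)⟩)
    have h2 : h ((x ^ k) s) + (n - k) ≤ h ((x ^ n) s) := hmx k n hk1 hkn.le le_rfl
    rw [hjb] at h1; rw [hv] at h2
    omega
  -- the lens set S = {s} ∪ x-prefix (k < n) ∪ y-prefix (l < m)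
  set S : Finset V := insert s (((Finset.Ico 1 n).image fun k => (x ^ k) s) ∪ ((Finset.Ico 1 m).image fun l => (y ^ l) s))
    with hSdef
  have memS_x : ∀ k, k < n → (x ^ k) s ∈ S := by
    intro k hk
    rcases Nat.eq_zero_or_pos k with h0 | hpos
    · subst h0; simp [hSdef]
    · rw [hSdef, Finset.mem_insert, Finset.mem_union]
      exact Or.inr (Or.inl (Finset.mem_image.mpr ⟨k, Finset.mem_Ico.mpr ⟨hpos, hk⟩, rfl⟩))
  have memS_y : ∀ l, l < m → (y ^ l) s ∈ S := by
    intro l hl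
    rcases Nat.eq_zero_or_pos l with h0 | hpos
    · subst h0; simp [hSdef]
    · rw [hSdef, Finset.mem_insert, Finset.mem_union]
      exact Or.inr (Or.inr (Finset.mem_image.mpr ⟨l, Finset.mem_Ico.mpr ⟨hpos, hl⟩, rfl⟩))
  -- T(c): every node `y^l s` with `1 ≤ l ≤ m` is an `x`-image of a node of `S`
  have hT : ∀ l, 1 ≤ l → l ≤ m → ∃ j ∈ S, x j = (y ^ l) s := by
    intro l hl1 hlm
    rcases Nat.eq_or_lt_of_le hlm with hEq | hlt
    · refine ⟨(x ^ (n - 1)) s, memS_x (n - 1) (by omega), ?_⟩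
      rw [← pow_succ_apply, Nat.sub_add_cancel hn, hv, hEq]
    · by_cases hmov : x ((y ^ l) s) = (y ^ l) s
      · exact ⟨(y ^ l) s, memS_y l hlt, hmov⟩
      · obtain ⟨k, hk1, hkn, hk⟩ := key_yx l hl1 hlt hmov
        refine ⟨(x ^ (k - 1)) s, memS_x (k - 1) (by omega), ?_⟩
        rw [← pow_succ_apply, Nat.sub_add_cancel hk1, hk]
  have hS : ∀ i ∈ S, ∃ j ∈ S, x j = y i := by
    intro i hi
    rw [hSdef, Finset.mem_insert, Finset.mem_union, Finset.mem_image, Finset.mem_image] at hi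
    rcases hi with rfl | ⟨k, hk, rfl⟩ | ⟨l, hl, rfl⟩
    · have := hT 1 le_rfl hm; rwa [pow_one] at this
    · rw [Finset.mem_Ico] at hk
      by_cases hmov : y ((x ^ k) s) = (x ^ k) s
      · refine ⟨(x ^ (k - 1)) s, memS_x (k - 1) (by omega), ?_⟩
        rw [← pow_succ_apply, Nat.sub_add_cancel hk.1, hmov]
      · obtain ⟨l, hl1, hlm, hl⟩ := key_xy k hk.1 hk.2 hmov
        rw [← hl, ← pow_succ_apply]
        exact hT (l + 1) (by omega) (by omega)
    · rw [Finset.mem_Ico] at hl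
      rw [← pow_succ_apply]
      exact hT (l + 1) (by omega) (by omega)
  -- `d` lies outside `S`
  have hdS : d ∉ S := by
    rw [hSdef, Finset.mem_insert, Finset.mem_union, Finset.mem_image, Finset.mem_image]
    rintro (rfl | ⟨k, hk, hkd⟩ | ⟨l, hl, hld⟩)
    · exact hds rfl
    · rw [Finset.mem_Ico] at hk; exact hdU (hkd ▸ hxn k hk.1 hk.2.le)
    · rw [Finset.mem_Ico] at hl; exact hdU (hld ▸ hym l hl.1 hl.2.le)
  -- the lens engine: no disagreement inside S
  have hagree : ∀ k, k < n → x ((x ^ k) s) = y ((x ^ k) s) := by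
    intro k hk
    by_contra hne
    exact not_lens_of_isCycle x y hc S hS (memS_x k hk) hne hdS hd
  -- conclusion: the prefixes coincide
  have hpref : ∀ k, k ≤ n → (x ^ k) s = (y ^ k) s := by
    intro k
    induction k with
    | zero => intro; simp
    | succ k ih =>
      intro hk
      rw [pow_succ_apply, pow_succ_apply, ← ih (by omega), hagree k (by omega)]
  refine ⟨?_, hpref⟩
  -- n = m from the common end point and strict heights on the y-prefix
  have hyn : (y ^ n) s = (y ^ m) s := by rw [← hpref n le_rfl, hv]
  by_contra hne
  rcases Nat.lt_or_gt_of_ne hne with hlt | hgt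
  · have := hmy n m hn hlt.le le_rfl
    rw [hyn] at this; omega
  · -- m < n: x^m s = y^m s = v = x^n s contradicts strict heights on the x-prefix
    have h1 := hmx m n hm hgt.le le_rfl
    rw [hpref m hgt.le, ← hv] at h1; omega

/-- **RIGIDITY LEMMA A, sharp side condition.**  As `prefix_rigidity`, but the witness `d` of `x d ≠ y d` only avoids the lens set
itself: `d ≠ s` and `d` is none of the prefix nodes `xᵏ s` (`1 ≤ k < n`), `yˡ s` (`1 ≤ l < m`) — the form used by THEOREM K1-J of the
memo (witness = the mark `p` above the common end `q` inside `U`; see `prefix_rigidity_high`). [this seat's theorem] -/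
theorem prefix_rigidity' (x y : Equiv.Perm V) (hc : (x⁻¹ * y).IsCycle) (s t : V) (h : V → ℕ)
    (hx : ∀ i, i ≠ s → i ≠ t → x i ≠ s → x i ≠ t → x i ≠ i → h i < h (x i))
    (hy : ∀ i, i ≠ s → i ≠ t → y i ≠ s → y i ≠ t → y i ≠ i → h i < h (y i))
    (U : Finset V) (hsU : s ∉ U) (htU : t ∉ U)
    (hUx : ∀ i, x i ∈ U → x i ≠ i → i ∈ U ∨ i = s) (hUy : ∀ i, y i ∈ U → y i ≠ i → i ∈ U ∨ i = s)
    {n m : ℕ} (hn : 1 ≤ n) (hm : 1 ≤ m)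
    (hxn : ∀ k, 1 ≤ k → k ≤ n → (x ^ k) s ∈ U) (hym : ∀ k, 1 ≤ k → k ≤ m → (y ^ k) s ∈ U)
    (hv : (x ^ n) s = (y ^ m) s)
    {d : V} (hd : x d ≠ y d) (hds : d ≠ s) (hdx : ∀ k, 1 ≤ k → k < n → (x ^ k) s ≠ d)
    (hdy : ∀ l, 1 ≤ l → l < m → (y ^ l) s ≠ d) :
    n = m ∧ ∀ k, k ≤ n → (x ^ k) s = (y ^ k) s := by
  -- basic facts: both colours move `s`; prefix nodes are non-gates
  have hxs : x s ≠ s := fun h' => hsU (by have := hxn 1 le_rfl hn; rwa [pow_one, h'] at this)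
  have hys : y s ≠ s := fun h' => hsU (by have := hym 1 le_rfl hm; rwa [pow_one, h'] at this)
  have hWx : ∀ k, 1 ≤ k → k ≤ n → (x ^ k) s ≠ s ∧ (x ^ k) s ≠ t :=
    fun k hk1 hk2 => ⟨fun h' => hsU (h' ▸ hxn k hk1 hk2), fun h' => htU (h' ▸ hxn k hk1 hk2)⟩
  have hWy : ∀ k, 1 ≤ k → k ≤ m → (y ^ k) s ≠ s ∧ (y ^ k) s ≠ t :=
    fun k hk1 hk2 => ⟨fun h' => hsU (h' ▸ hym k hk1 hk2), fun h' => htU (h' ▸ hym k hk1 hk2)⟩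
  -- heights along the prefixes
  have hmx : ∀ a b, 1 ≤ a → a ≤ b → b ≤ n → h ((x ^ a) s) + (b - a) ≤ h ((x ^ b) s) :=
    fun a b ha hab hb => height_mono_chain x s t h hx hxs hab (fun k hk1 hk2 => hWx k (by omega) (by omega))
  have hmy : ∀ a b, 1 ≤ a → a ≤ b → b ≤ m → h ((y ^ a) s) + (b - a) ≤ h ((y ^ b) s) :=
    fun a b ha hab hb => height_mono_chain y s t h hy hys hab (fun k hk1 hk2 => hWy k (by omega) (by omega))
  -- KEY: a `y`-prefix node moved by `x` is an `x`-prefix node (strictly before the end), and symmetrically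
  have key_yx : ∀ l, 1 ≤ l → l < m → x ((y ^ l) s) ≠ (y ^ l) s → ∃ k, 1 ≤ k ∧ k < n ∧ (x ^ k) s = (y ^ l) s := by
    intro l hl1 hlm hmov
    obtain ⟨j, hj1, hjb, hjU⟩ := backward_orbit x s t h hx U hsU htU hUx _ _ le_rfl (hym l hl1 hlm.le) hmov
    refine ⟨j, hj1, ?_, hjb⟩
    by_contra hjn
    push Not at hjn
    -- then v = x^n s lies on the x-chain before (or at) x^j s = y^l s, while the y-chain climbs from y^l s to v = y^m s
    have h1 : h ((x ^ n) s) + (j - n) ≤ h ((x ^ j) s) :=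
      height_mono_chain x s t h hx hxs hjn (fun k hk1 hk2 =>
        ⟨fun h' => hsU (h' ▸ hjU k (by omega) hk2), fun h' => htU (h' ▸ hjU k (by omega) hk2)⟩)
    have h2 : h ((y ^ l) s) + (m - l) ≤ h ((y ^ m) s) := hmy l m hl1 hlm.le le_rfl
    rw [hjb] at h1; rw [← hv] at h2
    omega
  have key_xy : ∀ k, 1 ≤ k → k < n → y ((x ^ k) s) ≠ (x ^ k) s → ∃ l, 1 ≤ l ∧ l < m ∧ (y ^ l) s = (x ^ k) s := by
    intro k hk1 hkn hmov
    obtain ⟨j, hj1, hjb, hjU⟩ := backward_orbit y s t h hy U hsU htU hUy _ _ le_rfl (hxn k hk1 hkn.le) hmov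
    refine ⟨j, hj1, ?_, hjb⟩
    by_contra hjm
    push Not at hjm
    have h1 : h ((y ^ m) s) + (j - m) ≤ h ((y ^ j) s) :=
      height_mono_chain y s t h hy hys hjm (fun k' hk1 hk2 =>
        ⟨fun h' => hsU (h' ▸ hjU k' (by omega) hk2), fun h' => htU (h' ▸ hjU k' (by omega) hk2)⟩)
    have h2 : h ((x ^ k) s) + (n - k) ≤ h ((x ^ n) s) := hmx k n hk1 hkn.le le_rfl
    rw [hjb] at h1; rw [hv] at h2
    omega
  -- the lens set S = {s} ∪ x-prefix (k < n) ∪ y-prefix (l < m)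
  set S : Finset V := insert s (((Finset.Ico 1 n).image fun k => (x ^ k) s) ∪ ((Finset.Ico 1 m).image fun l => (y ^ l) s))
    with hSdef
  have memS_x : ∀ k, k < n → (x ^ k) s ∈ S := by
    intro k hk
    rcases Nat.eq_zero_or_pos k with h0 | hpos
    · subst h0; simp [hSdef]
    · rw [hSdef, Finset.mem_insert, Finset.mem_union]
      exact Or.inr (Or.inl (Finset.mem_image.mpr ⟨k, Finset.mem_Ico.mpr ⟨hpos, hk⟩, rfl⟩))
  have memS_y : ∀ l, l < m → (y ^ l) s ∈ S := by
    intro l hl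
    rcases Nat.eq_zero_or_pos l with h0 | hpos
    · subst h0; simp [hSdef]
    · rw [hSdef, Finset.mem_insert, Finset.mem_union]
      exact Or.inr (Or.inr (Finset.mem_image.mpr ⟨l, Finset.mem_Ico.mpr ⟨hpos, hl⟩, rfl⟩))
  -- T(c): every node `y^l s` with `1 ≤ l ≤ m` is an `x`-image of a node of `S`
  have hT : ∀ l, 1 ≤ l → l ≤ m → ∃ j ∈ S, x j = (y ^ l) s := by
    intro l hl1 hlm
    rcases Nat.eq_or_lt_of_le hlm with hEq | hlt
    · refine ⟨(x ^ (n - 1)) s, memS_x (n - 1) (by omega), ?_⟩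
      rw [← pow_succ_apply, Nat.sub_add_cancel hn, hv, hEq]
    · by_cases hmov : x ((y ^ l) s) = (y ^ l) s
      · exact ⟨(y ^ l) s, memS_y l hlt, hmov⟩
      · obtain ⟨k, hk1, hkn, hk⟩ := key_yx l hl1 hlt hmov
        refine ⟨(x ^ (k - 1)) s, memS_x (k - 1) (by omega), ?_⟩
        rw [← pow_succ_apply, Nat.sub_add_cancel hk1, hk]
  have hS : ∀ i ∈ S, ∃ j ∈ S, x j = y i := by
    intro i hi
    rw [hSdef, Finset.mem_insert, Finset.mem_union, Finset.mem_image, Finset.mem_image] at hi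
    rcases hi with rfl | ⟨k, hk, rfl⟩ | ⟨l, hl, rfl⟩
    · have := hT 1 le_rfl hm; rwa [pow_one] at this
    · rw [Finset.mem_Ico] at hk
      by_cases hmov : y ((x ^ k) s) = (x ^ k) s
      · refine ⟨(x ^ (k - 1)) s, memS_x (k - 1) (by omega), ?_⟩
        rw [← pow_succ_apply, Nat.sub_add_cancel hk.1, hmov]
      · obtain ⟨l, hl1, hlm, hl⟩ := key_xy k hk.1 hk.2 hmov
        rw [← hl, ← pow_succ_apply]
        exact hT (l + 1) (by omega) (by omega)
    · rw [Finset.mem_Ico] at hl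
      rw [← pow_succ_apply]
      exact hT (l + 1) (by omega) (by omega)
  -- `d` lies outside `S`
  have hdS : d ∉ S := by
    rw [hSdef, Finset.mem_insert, Finset.mem_union, Finset.mem_image, Finset.mem_image]
    rintro (rfl | ⟨k, hk, hkd⟩ | ⟨l, hl, hld⟩)
    · exact hds rfl
    · rw [Finset.mem_Ico] at hk; exact hdx k hk.1 hk.2 hkd
    · rw [Finset.mem_Ico] at hl; exact hdy l hl.1 hl.2 hld
  -- the lens engine: no disagreement inside S
  have hagree : ∀ k, k < n → x ((x ^ k) s) = y ((x ^ k) s) := by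
    intro k hk
    by_contra hne
    exact not_lens_of_isCycle x y hc S hS (memS_x k hk) hne hdS hd
  -- conclusion: the prefixes coincide
  have hpref : ∀ k, k ≤ n → (x ^ k) s = (y ^ k) s := by
    intro k
    induction k with
    | zero => intro; simp
    | succ k ih =>
      intro hk
      rw [pow_succ_apply, pow_succ_apply, ← ih (by omega), hagree k (by omega)]
  refine ⟨?_, hpref⟩
  -- n = m from the common end point and strict heights on the y-prefix
  have hyn : (y ^ n) s = (y ^ m) s := by rw [← hpref n le_rfl, hv]
  by_contra hne
  rcases Nat.lt_or_gt_of_ne hne with hlt | hgt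
  · have := hmy n m hn hlt.le le_rfl
    rw [hyn] at this; omega
  · -- m < n: x^m s = y^m s = v = x^n s contradicts strict heights on the x-prefix
    have h1 := hmx m n hm hgt.le le_rfl
    rw [hpref m hgt.le, ← hv] at h1; omega

/-- **RIGIDITY LEMMA A, high witness.**  The sharp form with the witness condition discharged by heights: any `d ≠ s` with `x d ≠ y d` and
`h (xⁿ s) ≤ h d` (e.g. the common end node itself, or a node above it on either chain) lies outside the lens set. [this seat's theorem] -/
theorem prefix_rigidity_high (x y : Equiv.Perm V) (hc : (x⁻¹ * y).IsCycle) (s t : V) (h : V → ℕ)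
    (hx : ∀ i, i ≠ s → i ≠ t → x i ≠ s → x i ≠ t → x i ≠ i → h i < h (x i))
    (hy : ∀ i, i ≠ s → i ≠ t → y i ≠ s → y i ≠ t → y i ≠ i → h i < h (y i))
    (U : Finset V) (hsU : s ∉ U) (htU : t ∉ U)
    (hUx : ∀ i, x i ∈ U → x i ≠ i → i ∈ U ∨ i = s) (hUy : ∀ i, y i ∈ U → y i ≠ i → i ∈ U ∨ i = s)
    {n m : ℕ} (hn : 1 ≤ n) (hm : 1 ≤ m)
    (hxn : ∀ k, 1 ≤ k → k ≤ n → (x ^ k) s ∈ U) (hym : ∀ k, 1 ≤ k → k ≤ m → (y ^ k) s ∈ U)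
    (hv : (x ^ n) s = (y ^ m) s)
    {d : V} (hd : x d ≠ y d) (hds : d ≠ s) (hhd : h ((x ^ n) s) ≤ h d) :
    n = m ∧ ∀ k, k ≤ n → (x ^ k) s = (y ^ k) s := by
  have hxs : x s ≠ s := fun h' => hsU (by have := hxn 1 le_rfl hn; rwa [pow_one, h'] at this)
  have hys : y s ≠ s := fun h' => hsU (by have := hym 1 le_rfl hm; rwa [pow_one, h'] at this)
  refine prefix_rigidity' x y hc s t h hx hy U hsU htU hUx hUy hn hm hxn hym hv hd hds ?_ ?_
  · intro k hk1 hkn hkd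
    have := height_mono_chain x s t h hx hxs hkn.le (fun j hj1 hj2 =>
      ⟨fun h' => hsU (h' ▸ hxn j (by omega) hj2), fun h' => htU (h' ▸ hxn j (by omega) hj2)⟩)
    rw [hkd] at this; omega
  · intro l hl1 hlm hld
    have := height_mono_chain y s t h hy hys hlm.le (fun j hj1 hj2 =>
      ⟨fun h' => hsU (h' ▸ hym j (by omega) hj2), fun h' => htU (h' ▸ hym j (by omega) hj2)⟩)
    rw [hld, ← hv] at this; omega

end Core
end MarkedEdge
end Summit.ValiantsHypothesis.ValiantsHypothesis.Theorems.KPlusLogSqLaw
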